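import Summits.Parity.GeneralizedHardyLittlewood.Theses.LiouvilleShiftedTables
import Summits.Parity.GeneralizedHardyLittlewood.Theorems.TableChowla.Negative.TableChowlaPretenders
import Summits.Parity.GeneralizedHardyLittlewood.Theorems.TableChowla.Negative.TableChowlaOperatorNorm

/-!
# Disproof of `TableChowla` (stmt-Parity-14270) — gen-3 companion work file (`DisproofGen3.lean`)

Cycle-3 Lean content of the standing adversary (seat `refuter-cdisprove-stmt-Parity-14270-g3-0`,
2026-08-16), split off `Disproof.lean` for size (that file's docblock carries the full INDEX (a)–(p) and
the cycle-3 verdict). Imports the LANDED `Theorems/TableChowla/Negative/*` base (`TableChowlaFor`,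
`moment`, `momentN`, `rowCorr`, `lam`, `moment_pow`, `rpow_pow_one_div`, `absurd_of_le_div`, `chi4`,
`entry`, `OperatorNormForm`, `operatorNormForm_iff`, `operatorNormForm_of_tableChowla`). All sorry-free.

* (p) PERIODIC SYMBOLS FAIL AT EVERY PARAMETER POINT (row congruence): for a `q`-periodic symbol the rows
  `a ≡ a' (mod q)` of the table coincide, so `T ≥ #{a ≡ a'}·B² ≥ x²/(8q)`; hence
  `not_tableChowlaBoundAt_of_periodic` — every periodic `±1` pattern violates the crux's bound at every
  `(c, δ, C)`: the one-point (Siegel–Walfisz) content of the crux sits at ALL moduli `q ≤ 8(log x)^C`, not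
  only `q ∣ c` (cf. `Disproof.lean` (c′), (c″)). Landed copy: `Negative/TableChowlaPeriodicSymbols.lean`.
* (o) THE PICKED LINE'S RESIDUAL CUT IS VOID: `meanSquareCMAperiodic_iff : MeanSquareCMAperiodic ↔
  MeanSquareCM` for every `K` (kill one prime `p > ⌊y⌋`), hence `stubs_iff_inverse_and_aperiodic`,
  `tableChowla_of_inverse_aperiodic`, `inverseCM_of_tableChowla`: `TableChowla ↔ InverseCM ∧
  MeanSquareCMAperiodic`, the BV stub is logically redundant. Target-type finding on the registered stubs
  of `Lines/helson-kronecker-inverse.lean` (stub-misstated; repair: cut by periodicity / pretentious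
  distance of `g` ON THE COLUMNS `[1,⌊x/A⌋]`). Landed copy: `Negative/TableChowlaAperiodicVacuity.lean`
  (p74937).

* (q) THE RESIDUAL WITHOUT "CM" IS THE CRUX: `meanSquareBounded_iff : MeanSquareBounded ↔ TableChowla`
  (`MeanSquareBounded` = the line's `MeanSquareCM` with "completely multiplicative" deleted; →: test the
  table against its own rows `g = λ(a·+c)`; ←: `‖Mg‖² ≤ ‖g‖²√T` through the landed `rowform_sq_le` on real and
  imaginary parts). So the line's entire content is the extremality (up to log powers) of CM weights among
  bounded weights — its lever `InverseCM`. Landed copy: `Negative/TableChowlaResidualWithoutCM.lean` (p76622).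

* (r) THE WEAKEST LEVER closing the skeleton is the global implication `MinimalLever : MeanSquareCM →
  MeanSquareBounded` (≡ `MeanSquareCM → TableChowla`, `minimalLever_iff`), implied by `InverseCM` and by the
  crux; `tableChowla_iff_minimalLever : TableChowla ↔ MinimalLever ∧ MeanSquareCM` — a lead re-cutting
  `stub_inverse` can register exactly this (no pointwise dichotomy, no test vectors).

NUMERICS (kit job j010634, x = 10⁸, numpy, 96 s on 2 cores after 2.8 h in queue; script `job_gram/main.py`,
full per-run tables in the item evidence `summary_1e8.txt`). For c ∈ {1, −1, 2, 6} and A = x^σ: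
* σ = 5/12 (rows 2154, B = 46415, 2.32·10⁶ row pairs): off-diagonal energy / random model `rows(rows−1)B`
  = 1.0006, 0.9985, 1.0012, 1.0007; σ₁/(√rows+√B) = 0.9989, 0.9999, 0.9992, 0.9981; z = S(a,a')/√B over
  a < a': std 1.0003/0.9992/1.0006/1.0003, skew and excess kurtosis |·| < 0.004, max|z| = 5.20/5.11/5.12/5.37
  (Gaussian expectation 5.41), tails |z|>3: 6346/6219/6274/6355 vs 6260 expected, |z|>4: 128/142/174/159 vs 147, |z|>5: 2/2/1/3 vs 1.3; `C_eff = log(x²/T)/log log x = 2.62`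
  (diagonal-dominated: T ≈ rows·B² = x²/A).
* σ = 1/3 (rows 464, B = 215443): off/random = 0.9961, 0.9924, 1.0021, 1.0041; σ₁ ratio 0.9991–0.9999;
  max|z| 4.15–4.48 (exp 4.81). σ = 1/4 (rows 100, B = 10⁶): off/random = 0.984, 0.999, 1.018, 0.978
  (±0.02 = sampling error at 4950 pairs); σ₁ ratio 0.9993–1.0000.
* FAMILY SCAN (mean z and mean z² with t-statistics, per run): gcd classes (1, >1, 2, 3, 4, 6, 12, ≥50),
  gaps h = 1..12, h ∣ c, (a'/g) ∣ c, (a/g) ∣ c, both, ratios a'/a ∈ {3/2, 4/3, 5/4}, a ≡ a' mod 3,4,5,8,12,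
  a ≡ −a' (4), aa' ≡ 1 (8), aa' a square, both prime, both 30-smooth, and the λ(a)λ(a')-untwisted means:
  NO |t| ≥ 4 anywhere in 12 runs × 45 families (largest: a'/a = 5/4, t = +2.9 at c = 6, σ = 1/3, N = 69,
  sign not stable across runs). Column near-band k = 1..12: Σ_b G_col(b,b+k)²/(rows(B−k)) ∈ [0.990, 1.012],
  means |t| < 1.6. Top |z| pairs are structureless (gcd 1–7, generic ratios).
VERDICT: at x = 10⁸ the off-diagonal Gram entries of the λ-table are Gaussian with unit variance in every
tested arithmetic family — no trace of the structured biased family a refutation needs (landed (h):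
≫ A²/(log x)^{C₀} pairs with |S| ≫ B/(log x)^{C₀/2}); numerics cannot see log powers, so this is consistency,
not evidence of truth. Job j010697 (x = 10⁹, c ∈ {1,6}, σ ∈ {5/12,1/3}) was still queued when this cycle
closed; its headline numbers (off_ratio, σ₁ ratio, zmax per run) land automatically in the item's evidence
(job summary stderr tail) when it runs.
-/

namespace Summit.Parity.GeneralizedHardyLittlewood.Cruxes.TableChowla.DisproofGen3

open Finset Real ArithmeticFunction
open Summit.Parity.GeneralizedHardyLittlewood.Theses
-- only the landed base names are opened (the decls below are re-landed under `…Negative` with the same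
-- short names; opening the whole namespace would become ambiguous once they land)
open Summit.Parity.GeneralizedHardyLittlewood.Theorems.TableChowla.Negative
  (TableChowlaFor moment momentN rowCorr lam moment_pow rpow_pow_one_div absurd_of_le_div chi4 entry
    OperatorNormForm operatorNormForm_iff operatorNormForm_of_tableChowla rowform_sq_le abs_lam_le_one
    eventually_log_rpow_le entry_eq tableChowla_iff)

noncomputable section

variable {f : ℕ → ℝ} {c : ℤ}

/-! ## (p) Periodic symbols fail at every parameter point -/

/-- The crux's bound for the symbol `f` at ONE parameter point: shift `c`, window exponent `δ`,
log-power `C` (so `TableChowlaFor f ↔ ∀ c ≠ 0, ∀ δ ∈ (0,1/12], ∀ C > 0, TableChowlaBoundAt f c δ C`). -/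
def TableChowlaBoundAt (f : ℕ → ℝ) (c : ℤ) (δ C : ℝ) : Prop :=
  ∃ x₀ : ℝ, ∀ x : ℝ, x₀ ≤ x → ∀ A : ℝ, x ^ δ ≤ A → A ≤ x ^ (1 / 3 + δ) →
    moment f c x A ≤ x ^ 2 / Real.log x ^ C

/-- Quantifier bookkeeping: `TableChowlaFor` is the conjunction of its parameter points. -/
theorem tableChowlaFor_iff_boundAt :
    TableChowlaFor f ↔ ∀ c : ℤ, c ≠ 0 → ∀ δ : ℝ, 0 < δ → δ ≤ 1 / 12 → ∀ C : ℝ, 0 < C →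
      TableChowlaBoundAt f c δ C :=
  Iff.rfl

/-- ROW CONGRUENCE: for a `q`-periodic `±1`-valued symbol, two rows `a ≤ a'` with `q ∣ a' - a` have
full correlation `S_f(a,a') = B` (as soon as the table arguments are positive). -/
theorem rowCorr_eq_cols_of_periodic {q : ℕ} (hper : Function.Periodic f q)
    (hf : ∀ n, n ≠ 0 → f n ^ 2 = 1) {B a j : ℕ} (hpos : ∀ b ∈ Icc 1 B, 1 ≤ (a : ℤ) * b + c) :
    rowCorr f c B a (a + j * q) = B := by
  unfold rowCorr
  calc ∑ b ∈ Icc 1 B, f (Int.toNat ((a : ℤ) * b + c)) * f (Int.toNat (((a + j * q : ℕ) : ℤ) * b + c))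
      = ∑ b ∈ Icc 1 B, (1 : ℝ) := by
        refine sum_congr rfl fun b hb => ?_
        have h1 := hpos b hb
        have h0 : 0 ≤ (a : ℤ) * b + c := by linarith
        -- the second argument is the first plus `j*b` periods
        have harg : Int.toNat (((a + j * q : ℕ) : ℤ) * b + c) =
            Int.toNat ((a : ℤ) * b + c) + (j * b) * q := by
          have : ((a + j * q : ℕ) : ℤ) * b + c = ((a : ℤ) * b + c) + ((j * b * q : ℕ) : ℤ) := by
            push_cast; ring
          rw [this, Int.toNat_add_nat h0]
        have hperJ : Function.Periodic f ((j * b) * q) := by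
          have := hper.nat_mul (j * b)
          simpa using this
        rw [harg, hperJ, ← sq]
        apply hf
        intro hz
        rw [Int.toNat_eq_zero] at hz
        linarith
    _ = B := by simp

/-- LOWER BOUND: with rows `(m, 2m]`, `m = 4qn`, the pairs `(a, a + jq)` with `a ∈ (m, m+2qn]`,
`j < n` lie in the table and contribute `2qn · n · B²`; so `momentN ≥ 2qn²B²`. -/
theorem momentN_ge_of_periodic {q : ℕ} (hq : 1 ≤ q) (hper : Function.Periodic f q)
    (hf : ∀ n, n ≠ 0 → f n ^ 2 = 1) {n B : ℕ} (hc : -c ≤ (4 * q * n : ℕ)) :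
    (2 * q * n : ℕ) * n * (B : ℝ) ^ 2 ≤ momentN f c (4 * q * n) (2 * (4 * q * n)) B := by
  set m : ℕ := 4 * q * n with hm
  unfold momentN
  -- restrict the outer sum to `a ∈ (m, m + 2qn]`
  have hsub : Ioc m (m + 2 * q * n) ⊆ Ioc m (2 * m) := by
    intro a ha
    rw [mem_Ioc] at ha ⊢
    refine ⟨ha.1, ?_⟩
    have : m + 2 * q * n ≤ 2 * m := by rw [hm]; nlinarith [Nat.zero_le (q * n)]
    omega
  have hpos : ∀ a ∈ Ioc m (2 * m), ∀ b ∈ Icc 1 B, 1 ≤ (a : ℤ) * b + c := by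
    intro a ha b hb
    rw [mem_Ioc] at ha
    rw [mem_Icc] at hb
    have ha1 : (m : ℤ) + 1 ≤ a := by exact_mod_cast ha.1
    have hb1 : (1 : ℤ) ≤ b := by exact_mod_cast hb.1
    have hm0 : (0 : ℤ) ≤ m := by positivity
    have hcm : -c ≤ (m : ℤ) := by rw [hm]; exact hc
    nlinarith
  calc ((2 * q * n : ℕ) : ℝ) * n * (B : ℝ) ^ 2
      = ∑ _a ∈ Ioc m (m + 2 * q * n), ∑ _j ∈ range n, (B : ℝ) ^ 2 := by
        rw [sum_const, sum_const, Nat.card_Ioc, card_range, Nat.add_sub_cancel_left]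
        simp only [nsmul_eq_mul]
        push_cast
        ring
    _ = ∑ a ∈ Ioc m (m + 2 * q * n), ∑ j ∈ range n, rowCorr f c B a (a + j * q) ^ 2 := by
        refine sum_congr rfl fun a ha => sum_congr rfl fun j _ => ?_
        rw [rowCorr_eq_cols_of_periodic hper hf (hpos a (hsub ha))]
    _ = ∑ a ∈ Ioc m (m + 2 * q * n),
          ∑ a' ∈ (range n).image (fun j => a + j * q), rowCorr f c B a a' ^ 2 := by
        refine sum_congr rfl fun a _ => ?_
        rw [sum_image]
        intro j _ j' _ hjj'
        have h' : a + j * q = a + j' * q := hjj'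
        have h2 : j * q = j' * q := Nat.add_left_cancel h'
        exact Nat.eq_of_mul_eq_mul_right hq h2
    _ ≤ ∑ a ∈ Ioc m (m + 2 * q * n), ∑ a' ∈ Ioc m (2 * m), rowCorr f c B a a' ^ 2 := by
        refine sum_le_sum fun a ha => ?_
        refine sum_le_sum_of_subset_of_nonneg ?_ (fun _ _ _ => sq_nonneg _)
        intro a' ha'
        rw [mem_image] at ha'
        obtain ⟨j, hj, rfl⟩ := ha'
        rw [mem_range] at hj
        rw [mem_Ioc] at ha ⊢
        refine ⟨by omega, ?_⟩
        have h1 : j * q + q ≤ n * q := by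
          calc j * q + q = (j + 1) * q := by ring
            _ ≤ n * q := Nat.mul_le_mul_right q (Nat.succ_le_of_lt hj)
        have h3 : m + 2 * q * n + n * q ≤ 2 * m := by rw [hm]; nlinarith [Nat.zero_le (q * n)]
        have ha2 : a ≤ m + 2 * q * n := ha.2
        linarith
    _ ≤ ∑ a ∈ Ioc m (2 * m), ∑ a' ∈ Ioc m (2 * m), rowCorr f c B a a' ^ 2 :=
        sum_le_sum_of_subset_of_nonneg hsub (fun _ _ _ => sum_nonneg fun _ _ => sq_nonneg _)

/-- `(log x)^C` is eventually as large as we please. -/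
theorem eventually_le_log_rpow {C : ℝ} (hC : 0 < C) (M : ℝ) :
    ∃ X : ℝ, ∀ x : ℝ, X ≤ x → M ≤ Real.log x ^ C := by
  have h := ((tendsto_rpow_atTop hC).comp Real.tendsto_log_atTop).eventually (Filter.eventually_ge_atTop M)
  rw [Filter.eventually_atTop] at h
  obtain ⟨X, hX⟩ := h
  exact ⟨X, fun x hx => hX x hx⟩

/-- MAIN: a `q`-periodic `±1`-valued symbol violates the crux's bound at EVERY parameter point
`(c, δ, C)` with `0 < δ ≤ 1/12`, `0 < C` (any shift `c : ℤ`). At `x = m¹²`, `A = m = 4qn`: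
`x²/(8q) ≤ T ≤ x²/(log x)^C` is absurd once `(log x)^C > 8q`. -/
theorem not_tableChowlaBoundAt_of_periodic {q : ℕ} (hq : 1 ≤ q) (hper : Function.Periodic f q)
    (hf : ∀ n, n ≠ 0 → f n ^ 2 = 1) (c : ℤ) {δ : ℝ} (hδ : 0 < δ) (hδ' : δ ≤ 1 / 12) {C : ℝ}
    (hC : 0 < C) : ¬ TableChowlaBoundAt f c δ C := by
  rintro ⟨x₀, hx₀⟩
  obtain ⟨X, hX⟩ := eventually_le_log_rpow hC (8 * q + 1)
  obtain ⟨n, hn⟩ := exists_nat_ge (max (max x₀ X) (max ((Int.natAbs c : ℕ) : ℝ) 1))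
  have hnx₀ : x₀ ≤ n := le_trans (le_trans (le_max_left _ _) (le_max_left _ _)) hn
  have hnX : X ≤ n := le_trans (le_trans (le_max_right _ _) (le_max_left _ _)) hn
  have hnc : ((Int.natAbs c : ℕ) : ℝ) ≤ n := le_trans (le_trans (le_max_left _ _) (le_max_right _ _)) hn
  have hn1 : (1 : ℝ) ≤ n := le_trans (le_trans (le_max_right _ _) (le_max_right _ _)) hn
  have hn1' : 1 ≤ n := by exact_mod_cast hn1
  set m : ℕ := 4 * q * n with hm
  have hmn : n ≤ m := by rw [hm]; nlinarith [hq, Nat.zero_le (q * n)]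
  have hmn' : (n : ℝ) ≤ m := by exact_mod_cast hmn
  have hm1 : (1 : ℝ) ≤ m := le_trans hn1 hmn'
  have hm1' : 1 ≤ m := by exact_mod_cast hm1
  have hm0 : m ≠ 0 := by omega
  have hmpos : (0 : ℝ) < m := by linarith
  -- the scale `x = m ^ 12` and the row parameter `A = m`
  have hx1 : (1 : ℝ) ≤ (m : ℝ) ^ 12 := one_le_pow₀ hm1
  have hxm : (m : ℝ) ≤ (m : ℝ) ^ 12 := le_self_pow₀ hm1 (by norm_num)
  have hxx₀ : x₀ ≤ (m : ℝ) ^ 12 := hnx₀.trans (hmn'.trans hxm)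
  have hxX : X ≤ (m : ℝ) ^ 12 := hnX.trans (hmn'.trans hxm)
  have hA : (m : ℝ) = ((m : ℝ) ^ 12) ^ ((1 : ℝ) / 12) := by
    rw [show ((1 : ℝ) / 12) = (1 : ℝ) / (12 : ℕ) by norm_num]
    exact (rpow_pow_one_div 12 (by norm_num) m).symm
  have hw1 : ((m : ℝ) ^ 12) ^ δ ≤ m :=
    calc ((m : ℝ) ^ 12) ^ δ ≤ ((m : ℝ) ^ 12) ^ ((1 : ℝ) / 12) :=
          Real.rpow_le_rpow_of_exponent_le hx1 hδ'
      _ = m := hA.symm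
  have hw2 : (m : ℝ) ≤ ((m : ℝ) ^ 12) ^ (1 / 3 + δ) :=
    calc (m : ℝ) = ((m : ℝ) ^ 12) ^ ((1 : ℝ) / 12) := hA
      _ ≤ ((m : ℝ) ^ 12) ^ (1 / 3 + δ) := Real.rpow_le_rpow_of_exponent_le hx1 (by linarith)
  have key := hx₀ ((m : ℝ) ^ 12) hxx₀ m hw1 hw2
  rw [moment_pow f c (by norm_num) hm0, Real.log_pow] at key
  -- lower bound `2 q n² B² ≤ T`, `B = m¹¹`
  have hcm : -c ≤ ((4 * q * n : ℕ) : ℤ) := by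
    have h1 : -c ≤ (Int.natAbs c : ℤ) := by
      have h := (Int.le_natAbs : -c ≤ ((-c).natAbs : ℤ))
      rwa [Int.natAbs_neg] at h
    have h2 : ((Int.natAbs c : ℕ) : ℤ) ≤ (n : ℤ) := by exact_mod_cast (show (Int.natAbs c) ≤ n by exact_mod_cast hnc)
    have h3 : (n : ℤ) ≤ ((4 * q * n : ℕ) : ℤ) := by exact_mod_cast hmn
    linarith
  have hlow := momentN_ge_of_periodic hq hper hf (B := m ^ (12 - 1)) hcm
  rw [← hm] at hlow
  have hT := le_trans hlow key
  -- numerics: `2qn·n·(m¹¹)² = m²⁴/(8q)` since `m = 4qn`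
  have hmR : (m : ℝ) = 4 * q * n := by rw [hm]; push_cast; ring
  have hP : (0 : ℝ) < ((2 * q * n : ℕ) : ℝ) * n * ((m ^ (12 - 1) : ℕ) : ℝ) ^ 2 := by
    have hq' : (0 : ℝ) < q := by exact_mod_cast hq
    have hn' : (0 : ℝ) < n := by linarith
    push_cast
    positivity
  refine absurd_of_le_div hP (κ := 8 * q) (le_of_eq ?_) (by positivity) ?_ hT
  · push_cast
    rw [hmR]
    ring
  · have := hX _ hxX
    rw [Real.log_pow] at this
    push_cast at this ⊢
    linarith

/-- In particular `TableChowlaFor f` fails for every periodic `±1`-valued symbol (at `c = 1`,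
`δ = 1/12`, `C = 1`, say) — superseding `not_tableChowlaFor_one`. -/
theorem not_tableChowlaFor_of_periodic {q : ℕ} (hq : 1 ≤ q) (hper : Function.Periodic f q)
    (hf : ∀ n, n ≠ 0 → f n ^ 2 = 1) : ¬ TableChowlaFor f := fun h =>
  not_tableChowlaBoundAt_of_periodic hq hper hf 1 (by norm_num : (0 : ℝ) < 1 / 12) le_rfl one_pos
    (h 1 one_ne_zero (1 / 12) (by norm_num) le_rfl 1 one_pos)

/-- `f ≡ 1` re-derived (period 1). -/
example : ¬ TableChowlaFor (fun _ => 1) :=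
  not_tableChowlaFor_of_periodic (q := 1) le_rfl (fun _ => rfl) (fun _ _ => by norm_num)

/-- The alternating symbol `(-1)^n` (period 2) fails too, at every shift. -/
example (c : ℤ) {C : ℝ} (hC : 0 < C) :
    ¬ TableChowlaBoundAt (fun n => (-1 : ℝ) ^ n) c (1 / 12) C :=
  not_tableChowlaBoundAt_of_periodic (q := 2) (by norm_num)
    (fun n => by simp [pow_add]) (fun n _ => by rw [← pow_mul, mul_comm, pow_mul]; norm_num)
    c (by norm_num) le_rfl hC

/-- The COMPLETED character `χ₄⁺` (`χ₄` on odd `n`, `+1` on even `n`): 4-periodic, `±1`-valued,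
"pretends" to be `χ₄`. -/
def chi4plus (n : ℕ) : ℝ := if n % 4 = 3 then -1 else 1

/-- `χ₄⁺` is 4-periodic. -/
theorem chi4plus_periodic : Function.Periodic chi4plus 4 := fun n => by
  simp [chi4plus, Nat.add_mod_right]

/-- `χ₄⁺` is `±1`-valued. -/
theorem chi4plus_sq (n : ℕ) : chi4plus n ^ 2 = 1 := by
  unfold chi4plus; split_ifs <;> norm_num

/-- `χ₄⁺ = χ₄` on odd integers. -/
theorem chi4plus_eq_chi4_of_odd {n : ℕ} (hn : n % 2 = 1) : chi4plus n = chi4 n := by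
  have h4 : n % 4 = 1 ∨ n % 4 = 3 := by omega
  unfold chi4plus chi4
  rcases h4 with h | h <;> simp [h]

/-- … and it violates the crux's bound at EVERY shift `c` (not only `c = 4` as in
`not_tableChowlaFor_chi4`), every `δ ∈ (0,1/12]`, every `C > 0`. -/
theorem not_tableChowlaBoundAt_chi4plus (c : ℤ) {δ : ℝ} (hδ : 0 < δ) (hδ' : δ ≤ 1 / 12) {C : ℝ}
    (hC : 0 < C) : ¬ TableChowlaBoundAt chi4plus c δ C :=
  not_tableChowlaBoundAt_of_periodic (q := 4) (by norm_num) chi4plus_periodic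
    (fun n _ => chi4plus_sq n) c hδ hδ' hC

/-- READ-BACK for `λ`: the crux is `∀ c ≠ 0, ∀ δ ∈ (0,1/12], ∀ C > 0, TableChowlaBoundAt λ c δ C`. -/
theorem tableChowla_iff_boundAt :
    LiouvilleShiftedTables.TableChowla ↔ ∀ c : ℤ, c ≠ 0 → ∀ δ : ℝ, 0 < δ → δ ≤ 1 / 12 →
      ∀ C : ℝ, 0 < C → TableChowlaBoundAt lam c δ C :=
  Iff.rfl


/-! ## (o) The picked line's residual cut is void -/

/-! ## The skeleton's residual statements (verbatim) -/

/-- RESIDUAL of line `helson-kronecker-inverse` (verbatim): mean-square dispersion of the table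
against completely multiplicative 1-bounded column weights. -/
def MeanSquareCM : Prop :=
  ∀ c : ℤ, c ≠ 0 → ∀ δ : ℝ, 0 < δ → δ ≤ 1 / 12 → ∀ C : ℝ, 0 < C → ∃ x₀ : ℝ, ∀ x : ℝ, x₀ ≤ x →
    ∀ A : ℝ, x ^ δ ≤ A → A ≤ x ^ (1 / 3 + δ) →
    ∀ g : ℕ → ℂ, (∀ m n : ℕ, g (m * n) = g m * g n) → (∀ n : ℕ, ‖g n‖ ≤ 1) →
    ∀ y : ℝ, y ≤ x / A →
      ∑ a ∈ Finset.Ioc ⌊A⌋₊ ⌊2 * A⌋₊,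
          ‖∑ b ∈ Finset.Icc 1 ⌊y⌋₊, g b * (entry c a b : ℂ)‖ ^ 2 ≤
        x * (x / A) / Real.log x ^ C

/-- The skeleton's `MeanSquareCMPeriodic` (= `stub_periodic`, verbatim). -/
def MeanSquareCMPeriodic : Prop :=
  ∀ c : ℤ, c ≠ 0 → ∀ δ : ℝ, 0 < δ → δ ≤ 1 / 12 → ∀ C : ℝ, 0 < C → ∀ K : ℝ, 0 < K → ∃ x₀ : ℝ,
    ∀ x : ℝ, x₀ ≤ x → ∀ A : ℝ, x ^ δ ≤ A → A ≤ x ^ (1 / 3 + δ) →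
    ∀ g : ℕ → ℂ, (∀ m n : ℕ, g (m * n) = g m * g n) → (∀ n : ℕ, ‖g n‖ ≤ 1) →
    ∀ q : ℕ, 1 ≤ q → (q : ℝ) ≤ Real.log x ^ K → Function.Periodic g q →
    ∀ y : ℝ, y ≤ x / A →
      ∑ a ∈ Finset.Ioc ⌊A⌋₊ ⌊2 * A⌋₊,
          ‖∑ b ∈ Finset.Icc 1 ⌊y⌋₊, g b * (entry c a b : ℂ)‖ ^ 2 ≤
        x * (x / A) / Real.log x ^ C

/-- The skeleton's `MeanSquareCMAperiodic` (= `stub_aperiodic`, verbatim): the prover chooses `K`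
and only treats weights with NO period `q ≤ (log x)^K`. -/
def MeanSquareCMAperiodic : Prop :=
  ∀ c : ℤ, c ≠ 0 → ∀ δ : ℝ, 0 < δ → δ ≤ 1 / 12 → ∀ C : ℝ, 0 < C → ∃ K : ℝ, 0 < K ∧ ∃ x₀ : ℝ,
    ∀ x : ℝ, x₀ ≤ x → ∀ A : ℝ, x ^ δ ≤ A → A ≤ x ^ (1 / 3 + δ) →
    ∀ g : ℕ → ℂ, (∀ m n : ℕ, g (m * n) = g m * g n) → (∀ n : ℕ, ‖g n‖ ≤ 1) →
    (∀ q : ℕ, 1 ≤ q → (q : ℝ) ≤ Real.log x ^ K → ¬ Function.Periodic g q) →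
    ∀ y : ℝ, y ≤ x / A →
      ∑ a ∈ Finset.Ioc ⌊A⌋₊ ⌊2 * A⌋₊,
          ‖∑ b ∈ Finset.Icc 1 ⌊y⌋₊, g b * (entry c a b : ℂ)‖ ^ 2 ≤
        x * (x / A) / Real.log x ^ C

/-- The skeleton's lever `InverseCM` (= `stub_inverse`, verbatim). -/
def InverseCM : Prop :=
  ∀ c : ℤ, c ≠ 0 → ∀ δ : ℝ, 0 < δ → δ ≤ 1 / 12 → ∀ C : ℝ, 0 < C → ∃ C' : ℝ, 0 < C' ∧ ∃ x₀ : ℝ,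
    ∀ x : ℝ, x₀ ≤ x → ∀ A : ℝ, x ^ δ ≤ A → A ≤ x ^ (1 / 3 + δ) →
    ∀ u v : ℕ → ℝ, (∑ a ∈ Finset.Ioc ⌊A⌋₊ ⌊2 * A⌋₊, u a ^ 2 ≤ 1) →
      (∑ b ∈ Finset.Icc 1 ⌊x / A⌋₊, v b ^ 2 ≤ 1) →
      x ^ (1 / 2 : ℝ) / Real.log x ^ C ≤
        |∑ a ∈ Finset.Ioc ⌊A⌋₊ ⌊2 * A⌋₊, ∑ b ∈ Finset.Icc 1 ⌊x / A⌋₊, u a * v b * entry c a b| →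
      ∃ g : ℕ → ℂ, (∀ m n : ℕ, g (m * n) = g m * g n) ∧ (∀ n : ℕ, ‖g n‖ ≤ 1) ∧
        ∃ y : ℝ, y ≤ x / A ∧
          x * (x / A) / Real.log x ^ C' ≤
            ∑ a ∈ Finset.Ioc ⌊A⌋₊ ⌊2 * A⌋₊,
              ‖∑ b ∈ Finset.Icc 1 ⌊y⌋₊, g b * (entry c a b : ℂ)‖ ^ 2

/-! ## Killing one prime: an aperiodic completely multiplicative extension -/

/-- `g` with the prime `p` killed: `g' n = 0` if `p ∣ n`, else `g n`. -/
def killPrime (g : ℕ → ℂ) (p : ℕ) (n : ℕ) : ℂ := if p ∣ n then 0 else g n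

/-- Off the multiples of `p` the weight is unchanged. -/
theorem killPrime_of_not_dvd {g : ℕ → ℂ} {p n : ℕ} (h : ¬ p ∣ n) : killPrime g p n = g n := by
  simp [killPrime, h]

/-- On the multiples of `p` the weight vanishes. -/
theorem killPrime_of_dvd {g : ℕ → ℂ} {p n : ℕ} (h : p ∣ n) : killPrime g p n = 0 := by
  simp [killPrime, h]

/-- Killing a prime preserves complete multiplicativity. -/
theorem killPrime_mul {g : ℕ → ℂ} (hg : ∀ m n : ℕ, g (m * n) = g m * g n) {p : ℕ} (hp : p.Prime)
    (m n : ℕ) : killPrime g p (m * n) = killPrime g p m * killPrime g p n := by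
  by_cases hm : p ∣ m
  · rw [killPrime_of_dvd (dvd_mul_of_dvd_left hm n), killPrime_of_dvd hm, zero_mul]
  by_cases hn : p ∣ n
  · rw [killPrime_of_dvd (dvd_mul_of_dvd_right hn m), killPrime_of_dvd hn, mul_zero]
  have hmn : ¬ p ∣ m * n := fun h => (hp.dvd_mul.mp h).elim hm hn
  rw [killPrime_of_not_dvd hmn, killPrime_of_not_dvd hm, killPrime_of_not_dvd hn, hg]

/-- Killing a prime preserves 1-boundedness. -/
theorem norm_killPrime_le {g : ℕ → ℂ} (hg : ∀ n : ℕ, ‖g n‖ ≤ 1) (p n : ℕ) :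
    ‖killPrime g p n‖ ≤ 1 := by
  by_cases h : p ∣ n
  · rw [killPrime_of_dvd h, norm_zero]; exact zero_le_one
  · rw [killPrime_of_not_dvd h]; exact hg n

/-- On `[1, N]` with `N < p` nothing changes. -/
theorem killPrime_eq_on_Icc {g : ℕ → ℂ} {p N : ℕ} (hNp : N < p) {b : ℕ} (hb : b ∈ Icc 1 N) :
    killPrime g p b = g b := by
  rw [mem_Icc] at hb
  refine killPrime_of_not_dvd fun h => ?_
  have := Nat.eq_zero_of_dvd_of_lt h (lt_of_le_of_lt hb.2 hNp)
  omega

/-- APERIODICITY: if `g 1 ≠ 0` (no multiplicativity needed), then `killPrime g p` has no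
period `q` with `1 ≤ q < p` (Euler: `p^{φ(q)} = 1 + m q`, so a period `q` would force
`0 = g'(p^{φ(q)}) = g'(1) = g 1`). -/
theorem aperiodic_killPrime {g : ℕ → ℂ} (hg1 : g 1 ≠ 0)
    {p : ℕ} (hp : p.Prime) {q : ℕ} (hq1 : 1 ≤ q) (hqp : q < p) :
    ¬ Function.Periodic (killPrime g p) q := by
  intro hper
  -- `p` and `q` are coprime
  have hpq : Nat.Coprime p q := by
    refine hp.coprime_iff_not_dvd.mpr fun h => ?_
    have := Nat.le_of_dvd (by omega) h
    omega
  -- Euler: `p ^ φ(q) ≡ 1 (mod q)`, write `p ^ φ(q) = 1 + m * q`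
  have heul : p ^ q.totient ≡ 1 [MOD q] := Nat.ModEq.pow_totient hpq
  have hpow1 : 1 ≤ p ^ q.totient := Nat.one_le_pow _ _ hp.pos
  have hdvd : q ∣ p ^ q.totient - 1 := (Nat.modEq_iff_dvd' hpow1).mp heul.symm
  obtain ⟨m, hm⟩ := hdvd
  have hdecomp : p ^ q.totient = 1 + m * q := by
    have : p ^ q.totient - 1 = q * m := hm
    have h2 : p ^ q.totient = q * m + 1 := by omega
    rw [h2]; ring
  -- periodicity transported along `m * q`
  have hper' : Function.Periodic (killPrime g p) (m * q) := by
    have := hper.nat_mul m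
    simpa using this
  have hval : killPrime g p (1 + m * q) = killPrime g p 1 := hper' 1
  -- but `p ∣ p ^ φ(q)` (as `φ(q) ≥ 1`) and `p ∤ 1`
  have htot : 0 < q.totient := Nat.totient_pos.mpr (by omega)
  have hpdvd : p ∣ p ^ q.totient := dvd_pow_self p htot.ne'
  have hzero : killPrime g p (1 + m * q) = 0 := by
    rw [← hdecomp]; exact killPrime_of_dvd hpdvd
  have hone : killPrime g p 1 = g 1 := killPrime_of_not_dvd hp.not_dvd_one
  rw [hzero, hone] at hval
  exact hg1 hval.symm

/-- A completely multiplicative `g` with `g 1 = 0` vanishes identically. -/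
theorem cm_eq_zero_of_map_one {g : ℕ → ℂ} (hg : ∀ m n : ℕ, g (m * n) = g m * g n) (h1 : g 1 = 0)
    (n : ℕ) : g n = 0 := by
  have := hg 1 n
  rw [one_mul, h1, zero_mul] at this
  exact this

/-! ## The aperiodicity proviso is void -/

/-- MAIN LEMMA: for every `K`, the aperiodic residual implies the full residual. Given any CM
1-bounded `g` and `y ≤ x/A`, kill a prime `p > max(⌊y⌋, ⌊(log x)^K⌋)`: the new weight is CM,
1-bounded, has no period `≤ (log x)^K`, and gives the same column sums on `b ≤ ⌊y⌋`. -/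
theorem meanSquareCM_of_aperiodic (h : MeanSquareCMAperiodic) : MeanSquareCM := by
  intro c hc δ hδ hδ' C hC
  obtain ⟨K, hK, x₀, hx₀⟩ := h c hc δ hδ hδ' C hC
  refine ⟨max x₀ 1, ?_⟩
  intro x hx A hA hA' g hgm hgb y hy
  have hx₀' : x₀ ≤ x := le_trans (le_max_left _ _) hx
  have hx1 : (1 : ℝ) ≤ x := le_trans (le_max_right _ _) hx
  have hx0 : (0 : ℝ) ≤ x := by linarith
  have hxpos : (0 : ℝ) < x := by linarith
  have hApos : 0 < A := lt_of_lt_of_le (Real.rpow_pos_of_pos hxpos δ) hA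
  have hL0 : 0 ≤ Real.log x := Real.log_nonneg hx1
  by_cases hg1 : g 1 = 0
  · -- `g ≡ 0`: the left side vanishes
    have hzero : ∀ a : ℕ, ‖∑ b ∈ Icc 1 ⌊y⌋₊, g b * (entry c a b : ℂ)‖ ^ 2 = 0 := by
      intro a
      rw [sum_eq_zero fun b _ => by rw [cm_eq_zero_of_map_one hgm hg1 b, zero_mul], norm_zero]
      ring
    rw [sum_eq_zero fun a _ => hzero a]
    exact div_nonneg (mul_nonneg hx0 (div_nonneg hx0 hApos.le)) (Real.rpow_nonneg hL0 C)
  -- kill a prime beyond the columns and beyond `(log x)^K`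
  obtain ⟨p, hpN, hp⟩ := Nat.exists_infinite_primes (max ⌊y⌋₊ ⌊Real.log x ^ K⌋₊ + 1)
  have hpy : ⌊y⌋₊ < p := by
    have := le_max_left ⌊y⌋₊ ⌊Real.log x ^ K⌋₊; omega
  have hpK : ⌊Real.log x ^ K⌋₊ < p := by
    have := le_max_right ⌊y⌋₊ ⌊Real.log x ^ K⌋₊; omega
  have haper : ∀ q : ℕ, 1 ≤ q → (q : ℝ) ≤ Real.log x ^ K →
      ¬ Function.Periodic (killPrime g p) q := by
    intro q hq1 hqK
    have hqfloor : q ≤ ⌊Real.log x ^ K⌋₊ := (Nat.le_floor_iff (Real.rpow_nonneg hL0 K)).mpr hqK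
    exact aperiodic_killPrime hg1 hp hq1 (lt_of_le_of_lt hqfloor hpK)
  have hbound := hx₀ x hx₀' A hA hA' (killPrime g p) (killPrime_mul hgm hp)
    (norm_killPrime_le hgb p) haper y hy
  -- the column sums agree on `b ≤ ⌊y⌋ < p`
  have hsame : ∀ a : ℕ, ∑ b ∈ Icc 1 ⌊y⌋₊, killPrime g p b * (entry c a b : ℂ) =
      ∑ b ∈ Icc 1 ⌊y⌋₊, g b * (entry c a b : ℂ) := fun a =>
    sum_congr rfl fun b hb => by rw [killPrime_eq_on_Icc hpy hb]
  simp_rw [hsame] at hbound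
  exact hbound

/-- … so the aperiodic stub's statement is EQUIVALENT to the full residual, for every `K`. -/
theorem meanSquareCMAperiodic_iff : MeanSquareCMAperiodic ↔ MeanSquareCM := by
  refine ⟨meanSquareCM_of_aperiodic, fun h c hc δ hδ hδ' C hC => ?_⟩
  obtain ⟨x₀, hx₀⟩ := h c hc δ hδ hδ' C hC
  exact ⟨1, one_pos, x₀, fun x hx A hA hA' g hgm hgb _ y hy => hx₀ x hx A hA hA' g hgm hgb y hy⟩

/-- … and in particular the aperiodic stub already contains the periodic one (the BV branch
`stub_bv` + `stub_periodic_of_bv` of the skeleton is logically redundant). -/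
theorem meanSquareCMPeriodic_of_aperiodic (h : MeanSquareCMAperiodic) : MeanSquareCMPeriodic := by
  intro c hc δ hδ hδ' C hC K _
  obtain ⟨x₀, hx₀⟩ := meanSquareCM_of_aperiodic h c hc δ hδ hδ' C hC
  exact ⟨x₀, fun x hx A hA hA' g hgm hgb _ _ _ _ y hy => hx₀ x hx A hA hA' g hgm hgb y hy⟩

/-- The full residual trivially gives the periodic one. -/
theorem meanSquareCMPeriodic_of_meanSquareCM (h : MeanSquareCM) : MeanSquareCMPeriodic :=
  meanSquareCMPeriodic_of_aperiodic (meanSquareCMAperiodic_iff.mpr h)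

/-- COLLAPSE OF THE SPLITTING: the skeleton's registered stub conjunction is equivalent to
`InverseCM ∧ MeanSquareCMAperiodic` — two stubs, not three. -/
theorem stubs_iff_inverse_and_aperiodic :
    (InverseCM ∧ MeanSquareCMPeriodic ∧ MeanSquareCMAperiodic) ↔ (InverseCM ∧ MeanSquareCMAperiodic) :=
  ⟨fun h => ⟨h.1, h.2.2⟩, fun h => ⟨h.1, meanSquareCMPeriodic_of_aperiodic h.2, h.2⟩⟩

/-! ## Composition on the landed operator-norm form (pure logic, as in the skeleton) -/

/-- The dichotomy closes (skeleton's `operatorNormForm_of_inverse_msed`, on `Negative.OperatorNormForm`):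
the inverse theorem at level `C` and the residual at level `C'+1` are incompatible with a
near-extremal pair of test vectors once `log x > 1`. -/
theorem operatorNormForm_of_inverse_meanSquare (hI : InverseCM) (hM : MeanSquareCM) :
    OperatorNormForm := by
  intro c hc δ hδ hδ' C hC
  obtain ⟨C', hC', x₁, h1⟩ := hI c hc δ hδ hδ' C hC
  obtain ⟨x₂, h2⟩ := hM c hc δ hδ hδ' (C' + 1) (by linarith)
  refine ⟨max (max x₁ x₂) 3, ?_⟩
  intro x hx A hA hA' u v hu hv
  have hx₁ : x₁ ≤ x := le_trans (le_trans (le_max_left _ _) (le_max_left _ _)) hx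
  have hx₂ : x₂ ≤ x := le_trans (le_trans (le_max_right _ _) (le_max_left _ _)) hx
  have hx3 : (3 : ℝ) ≤ x := le_trans (le_max_right _ _) hx
  by_contra hlt
  push Not at hlt
  obtain ⟨g, hgm, hgb, y, hy, hbig⟩ := h1 x hx₁ A hA hA' u v hu hv hlt.le
  have hsmall := h2 x hx₂ A hA hA' g hgm hgb y hy
  have hxpos : 0 < x := by linarith
  have hApos : 0 < A := lt_of_lt_of_le (Real.rpow_pos_of_pos hxpos δ) hA
  have hnum : 0 < x * (x / A) := mul_pos hxpos (div_pos hxpos hApos)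
  have hlog : 1 < Real.log x := by
    rw [Real.lt_log_iff_exp_lt hxpos]
    exact lt_of_lt_of_le (lt_trans Real.exp_one_lt_d9 (by norm_num)) hx3
  have hLpos : 0 < Real.log x := by linarith
  have hpow : Real.log x ^ C' < Real.log x ^ (C' + 1) :=
    Real.rpow_lt_rpow_of_exponent_lt hlog (by linarith)
  have hlt' : x * (x / A) / Real.log x ^ (C' + 1) < x * (x / A) / Real.log x ^ C' :=
    div_lt_div_of_pos_left hnum (Real.rpow_pos_of_pos hLpos C') hpow
  linarith

/-- TWO stubs suffice: `InverseCM ∧ MeanSquareCMAperiodic → TableChowla` (the periodic / BV stub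
is not needed). -/
theorem tableChowla_of_inverse_aperiodic (hI : InverseCM) (hA : MeanSquareCMAperiodic) :
    LiouvilleShiftedTables.TableChowla :=
  operatorNormForm_iff.mp (operatorNormForm_of_inverse_meanSquare hI (meanSquareCM_of_aperiodic hA))

/-- Under the crux the inverse theorem holds vacuously (its premise never fires beyond `x₀`;
skeleton's `inverseCM_of_tableChowla`, via the landed `operatorNormForm_of_tableChowla`). -/
theorem inverseCM_of_tableChowla (hTC : LiouvilleShiftedTables.TableChowla) : InverseCM := by
  intro c hc δ hδ hδ' C hC
  obtain ⟨x₁, h1⟩ := operatorNormForm_of_tableChowla hTC c hc δ hδ hδ' (C + 1) (by linarith)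
  refine ⟨1, one_pos, max x₁ 3, ?_⟩
  intro x hx A hA hA' u v hu hv hbig
  exfalso
  have hx₁ : x₁ ≤ x := le_trans (le_max_left _ _) hx
  have hx3 : (3 : ℝ) ≤ x := le_trans (le_max_right _ _) hx
  have hxpos : 0 < x := by linarith
  have hsmall := h1 x hx₁ A hA hA' u v hu hv
  have hlog : 1 < Real.log x := by
    rw [Real.lt_log_iff_exp_lt hxpos]
    exact lt_of_lt_of_le (lt_trans Real.exp_one_lt_d9 (by norm_num)) hx3
  have hLpos : 0 < Real.log x := by linarith
  have hpow : Real.log x ^ C < Real.log x ^ (C + 1) :=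
    Real.rpow_lt_rpow_of_exponent_lt hlog (by linarith)
  have hnum : 0 < x ^ (1 / 2 : ℝ) := Real.rpow_pos_of_pos hxpos _
  have hlt : x ^ (1 / 2 : ℝ) / Real.log x ^ (C + 1) < x ^ (1 / 2 : ℝ) / Real.log x ^ C :=
    div_lt_div_of_pos_left hnum (Real.rpow_pos_of_pos hLpos C) hpow
  linarith


/-! ## (q) The residual without "CM" is the crux -/

/-- The line's residual with the multiplicativity clause deleted: mean-square dispersion of the table
against EVERY 1-bounded complex column weight. -/
def MeanSquareBounded : Prop :=
  ∀ c : ℤ, c ≠ 0 → ∀ δ : ℝ, 0 < δ → δ ≤ 1 / 12 → ∀ C : ℝ, 0 < C → ∃ x₀ : ℝ, ∀ x : ℝ, x₀ ≤ x →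
    ∀ A : ℝ, x ^ δ ≤ A → A ≤ x ^ (1 / 3 + δ) →
    ∀ g : ℕ → ℂ, (∀ n : ℕ, ‖g n‖ ≤ 1) →
    ∀ y : ℝ, y ≤ x / A →
      ∑ a ∈ Finset.Ioc ⌊A⌋₊ ⌊2 * A⌋₊,
          ‖∑ b ∈ Finset.Icc 1 ⌊y⌋₊, g b * (entry c a b : ℂ)‖ ^ 2 ≤
        x * (x / A) / Real.log x ^ C

/-- `‖Σ g_b e_b‖² = (Σ Re g_b · e_b)² + (Σ Im g_b · e_b)²` for real `e`. -/
theorem norm_sq_sum_mul_ofReal (g : ℕ → ℂ) (e : ℕ → ℝ) (S : Finset ℕ) :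
    ‖∑ b ∈ S, g b * (e b : ℂ)‖ ^ 2 =
      (∑ b ∈ S, (g b).re * e b) ^ 2 + (∑ b ∈ S, (g b).im * e b) ^ 2 := by
  rw [Complex.sq_norm, Complex.normSq_apply, Complex.re_sum, Complex.im_sum]
  have hre : ∀ b, (g b * (e b : ℂ)).re = (g b).re * e b := fun b => by simp
  have him : ∀ b, (g b * (e b : ℂ)).im = (g b).im * e b := fun b => by simp
  simp_rw [hre, him]
  ring

/-- Testing against a ROW: with `g = row a` the mean square over `a'` is `Σ_{a'} S(a,a')²`. -/
theorem norm_sq_row_weight (c : ℤ) (B a a' : ℕ) :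
    ‖∑ b ∈ Icc 1 B, (entry c a b : ℂ) * (entry c a' b : ℂ)‖ ^ 2 = rowCorr lam c B a a' ^ 2 := by
  have : ∑ b ∈ Icc 1 B, (entry c a b : ℂ) * (entry c a' b : ℂ) = ((rowCorr lam c B a a' : ℝ) : ℂ) := by
    unfold rowCorr
    push_cast
    rfl
  rw [this, Complex.norm_real, Real.norm_eq_abs, sq_abs]

/-- The number of rows is at most `2A`. -/
theorem rows_le_two_mul {A : ℝ} (hA : 0 ≤ A) : ((⌊2 * A⌋₊ - ⌊A⌋₊ : ℕ) : ℝ) ≤ 2 * A :=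
  le_trans (by exact_mod_cast Nat.sub_le _ _) (Nat.floor_le (by positivity))

/-- `MeanSquareBounded → TableChowla`: sum the residual over the table's own rows. -/
theorem tableChowla_of_meanSquareBounded (h : MeanSquareBounded) : LiouvilleShiftedTables.TableChowla := by
  rw [tableChowla_iff]
  intro c hc δ hδ hδ' C hC
  obtain ⟨x₀, hx₀⟩ := h c hc δ hδ hδ' (C + 1) (by linarith)
  obtain ⟨X, hX⟩ := eventually_log_rpow_le hδ C
  refine ⟨max (max x₀ X) 1, fun x hx A hA hA' => ?_⟩
  have hx₀' : x₀ ≤ x := le_trans (le_trans (le_max_left _ _) (le_max_left _ _)) hx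
  have hxX : X ≤ x := le_trans (le_trans (le_max_right _ _) (le_max_left _ _)) hx
  have hx1 : (1 : ℝ) ≤ x := le_trans (le_max_right _ _) hx
  have hxpos : (0 : ℝ) < x := by linarith
  have hApos : 0 < A := lt_of_lt_of_le (Real.rpow_pos_of_pos hxpos δ) hA
  have hlog2 : 2 ≤ Real.log x := (hX x hxX).2
  have hLpos : 0 < Real.log x := by linarith
  set L : ℝ := Real.log x with hL
  -- each row as a test weight
  have hrow : ∀ a ∈ Ioc ⌊A⌋₊ ⌊2 * A⌋₊,
      ∑ a' ∈ Ioc ⌊A⌋₊ ⌊2 * A⌋₊, rowCorr lam c ⌊x / A⌋₊ a a' ^ 2 ≤ x * (x / A) / L ^ (C + 1) := by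
    intro a _
    have hg : ∀ n : ℕ, ‖((entry c a n : ℝ) : ℂ)‖ ≤ 1 := fun n => by
      rw [Complex.norm_real, Real.norm_eq_abs, entry_eq]; exact abs_lam_le_one _
    have key := hx₀ x hx₀' A hA hA' (fun b => (entry c a b : ℂ)) hg (x / A) le_rfl
    simp_rw [norm_sq_row_weight] at key
    exact key
  show momentN lam c ⌊A⌋₊ ⌊2 * A⌋₊ ⌊x / A⌋₊ ≤ x ^ 2 / Real.log x ^ C
  unfold momentN
  calc ∑ a ∈ Ioc ⌊A⌋₊ ⌊2 * A⌋₊, ∑ a' ∈ Ioc ⌊A⌋₊ ⌊2 * A⌋₊, rowCorr lam c ⌊x / A⌋₊ a a' ^ 2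
      ≤ ∑ _a ∈ Ioc ⌊A⌋₊ ⌊2 * A⌋₊, x * (x / A) / L ^ (C + 1) := sum_le_sum hrow
    _ = ((⌊2 * A⌋₊ - ⌊A⌋₊ : ℕ) : ℝ) * (x * (x / A) / L ^ (C + 1)) := by
        rw [sum_const, Nat.card_Ioc, nsmul_eq_mul]
    _ ≤ (2 * A) * (x * (x / A) / L ^ (C + 1)) := by
        refine mul_le_mul_of_nonneg_right (rows_le_two_mul hApos.le) ?_
        exact div_nonneg (by positivity) (Real.rpow_nonneg hLpos.le _)
    _ = 2 * x ^ 2 / (L ^ C * L) := by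
        rw [Real.rpow_add_one hLpos.ne' C]
        field_simp
    _ ≤ x ^ 2 / L ^ C := by
        have hLC : 0 < L ^ C := Real.rpow_pos_of_pos hLpos C
        rw [div_le_div_iff₀ (by positivity) hLC]
        nlinarith [mul_nonneg (sq_nonneg x) hLC.le, mul_pos hLC hLC]

/-- `TableChowla → MeanSquareBounded`: `‖M g‖² ≤ ‖g‖² √T ≤ (x/A) · x/(log x)^C` (crux at level `2C`;
real and imaginary parts of `g`, zero-extended from `[1,⌊y⌋]` to all columns, through `rowform_sq_le`). -/
theorem meanSquareBounded_of_tableChowla (h : LiouvilleShiftedTables.TableChowla) : MeanSquareBounded := by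
  intro c hc δ hδ hδ' C hC
  obtain ⟨x₀, hx₀⟩ := (tableChowla_iff.mp h) c hc δ hδ hδ' (2 * C) (by linarith)
  refine ⟨max x₀ 1, fun x hx A hA hA' g hg y hy => ?_⟩
  have hx₀' : x₀ ≤ x := le_trans (le_max_left _ _) hx
  have hx1 : (1 : ℝ) ≤ x := le_trans (le_max_right _ _) hx
  have hx0 : (0 : ℝ) ≤ x := by linarith
  have hxpos : (0 : ℝ) < x := by linarith
  have hApos : 0 < A := lt_of_lt_of_le (Real.rpow_pos_of_pos hxpos δ) hA
  have hL0 : 0 ≤ Real.log x := Real.log_nonneg hx1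
  set B : ℕ := ⌊x / A⌋₊ with hB
  set N : ℕ := ⌊y⌋₊ with hN
  have hNB : N ≤ B := Nat.floor_mono hy
  have hT : momentN lam c ⌊A⌋₊ ⌊2 * A⌋₊ B ≤ x ^ 2 / Real.log x ^ (2 * C) := hx₀ x hx₀' A hA hA'
  -- zero-extended real and imaginary weights
  set wr : ℕ → ℝ := fun b => if b ≤ N then (g b).re else 0 with hwr
  set wi : ℕ → ℝ := fun b => if b ≤ N then (g b).im else 0 with hwi
  have hfilter : (Icc 1 B).filter (fun b => b ≤ N) = Icc 1 N := by
    ext b; simp only [mem_filter, mem_Icc]; omega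
  have hsum_ext : ∀ (w : ℕ → ℝ) (a : ℕ),
      ∑ b ∈ Icc 1 B, (if b ≤ N then w b else 0) * lam (Int.toNat ((a : ℤ) * b + c)) =
        ∑ b ∈ Icc 1 N, w b * entry c a b := by
    intro w a
    rw [← hfilter, sum_filter]
    refine sum_congr rfl fun b _ => ?_
    split_ifs <;> simp [entry_eq]
  have hsq_ext : ∀ (w : ℕ → ℝ), ∑ b ∈ Icc 1 B, (if b ≤ N then w b else 0) ^ 2 =
      ∑ b ∈ Icc 1 N, w b ^ 2 := by
    intro w
    rw [← hfilter, sum_filter]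
    refine sum_congr rfl fun b _ => ?_
    split_ifs <;> simp
  have hr := rowform_sq_le (f := lam) (c := c) (A₁ := ⌊A⌋₊) (A₂ := ⌊2 * A⌋₊) (B := B) wr
  have hi := rowform_sq_le (f := lam) (c := c) (A₁ := ⌊A⌋₊) (A₂ := ⌊2 * A⌋₊) (B := B) wi
  simp only [hwr, hwi] at hr hi
  simp_rw [hsum_ext] at hr hi
  rw [hsq_ext] at hr hi
  -- assemble `‖Mg‖² = Σ (re part)² + Σ (im part)² ≤ (Σ re² + Σ im²) √T = ‖g‖² √T`
  have hsplit : ∑ a ∈ Ioc ⌊A⌋₊ ⌊2 * A⌋₊, ‖∑ b ∈ Icc 1 N, g b * (entry c a b : ℂ)‖ ^ 2 =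
      ∑ a ∈ Ioc ⌊A⌋₊ ⌊2 * A⌋₊, (∑ b ∈ Icc 1 N, (g b).re * entry c a b) ^ 2 +
        ∑ a ∈ Ioc ⌊A⌋₊ ⌊2 * A⌋₊, (∑ b ∈ Icc 1 N, (g b).im * entry c a b) ^ 2 := by
    rw [← sum_add_distrib]
    exact sum_congr rfl fun a _ => norm_sq_sum_mul_ofReal g (entry c a) _
  have hg2 : ∑ b ∈ Icc 1 N, (g b).re ^ 2 + ∑ b ∈ Icc 1 N, (g b).im ^ 2 ≤ x / A := by
    rw [← sum_add_distrib]
    calc ∑ b ∈ Icc 1 N, ((g b).re ^ 2 + (g b).im ^ 2) = ∑ b ∈ Icc 1 N, ‖g b‖ ^ 2 := by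
          refine sum_congr rfl fun b _ => ?_
          rw [Complex.sq_norm, Complex.normSq_apply]; ring
      _ ≤ ∑ _b ∈ Icc 1 N, (1 : ℝ) := sum_le_sum fun b _ => pow_le_one₀ (norm_nonneg _) (hg b)
      _ = (N : ℝ) := by simp
      _ ≤ (B : ℝ) := by exact_mod_cast hNB
      _ ≤ x / A := Nat.floor_le (div_nonneg hx0 hApos.le)
  have hsqrtT : Real.sqrt (momentN lam c ⌊A⌋₊ ⌊2 * A⌋₊ B) ≤ x / Real.log x ^ C := by
    have hpow : Real.log x ^ (2 * C) = (Real.log x ^ C) ^ 2 := by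
      rw [mul_comm, Real.rpow_mul hL0, Real.rpow_two]
    calc Real.sqrt _ ≤ Real.sqrt (x ^ 2 / Real.log x ^ (2 * C)) := Real.sqrt_le_sqrt hT
      _ = x / Real.log x ^ C := by
          rw [hpow, ← div_pow, Real.sqrt_sq (div_nonneg hx0 (Real.rpow_nonneg hL0 C))]
  have hsqrt0 : 0 ≤ Real.sqrt (momentN lam c ⌊A⌋₊ ⌊2 * A⌋₊ B) := Real.sqrt_nonneg _
  rw [hsplit]
  calc ∑ a ∈ Ioc ⌊A⌋₊ ⌊2 * A⌋₊, (∑ b ∈ Icc 1 N, (g b).re * entry c a b) ^ 2 +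
        ∑ a ∈ Ioc ⌊A⌋₊ ⌊2 * A⌋₊, (∑ b ∈ Icc 1 N, (g b).im * entry c a b) ^ 2
      ≤ (∑ b ∈ Icc 1 N, (g b).re ^ 2) * Real.sqrt (momentN lam c ⌊A⌋₊ ⌊2 * A⌋₊ B) +
        (∑ b ∈ Icc 1 N, (g b).im ^ 2) * Real.sqrt (momentN lam c ⌊A⌋₊ ⌊2 * A⌋₊ B) :=
        add_le_add hr hi
    _ = (∑ b ∈ Icc 1 N, (g b).re ^ 2 + ∑ b ∈ Icc 1 N, (g b).im ^ 2) *
          Real.sqrt (momentN lam c ⌊A⌋₊ ⌊2 * A⌋₊ B) := by ring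
    _ ≤ (x / A) * (x / Real.log x ^ C) := mul_le_mul hg2 hsqrtT hsqrt0 (div_nonneg hx0 hApos.le)
    _ = x * (x / A) / Real.log x ^ C := by ring

/-- THE RESIDUAL WITHOUT "CM" IS THE CRUX. -/
theorem meanSquareBounded_iff : MeanSquareBounded ↔ LiouvilleShiftedTables.TableChowla :=
  ⟨tableChowla_of_meanSquareBounded, meanSquareBounded_of_tableChowla⟩


/-! ## (r) The WEAKEST lever that closes the picked skeleton

The skeleton uses `InverseCM` only through `InverseCM → MeanSquareCM → OperatorNormForm`. So the weakest
registered lever that still closes it is the GLOBAL implication `MeanSquareCM → TableChowla`, which by (q)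
reads `MinimalLever : MeanSquareCM → MeanSquareBounded` — "dispersion against completely multiplicative
weights implies dispersion against all bounded weights" (no pointwise-in-`(x, A)` dichotomy, no test vectors).
It is implied by `InverseCM` (`minimalLever_of_inverseCM`) and by the crux (`minimalLever_of_tableChowla`),
and `TableChowla ↔ MinimalLever ∧ MeanSquareCM` (`tableChowla_iff_minimalLever`). A lead re-cutting
`stub_inverse` can register exactly this. -/

/-- The minimal lever: CM-dispersion implies bounded-weight dispersion. -/
def MinimalLever : Prop := MeanSquareCM → MeanSquareBounded

/-- … equivalently `MeanSquareCM → TableChowla`. -/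
theorem minimalLever_iff : MinimalLever ↔ (MeanSquareCM → LiouvilleShiftedTables.TableChowla) :=
  ⟨fun h hM => tableChowla_of_meanSquareBounded (h hM),
    fun h hM => meanSquareBounded_of_tableChowla (h hM)⟩

/-- The skeleton's lever implies the minimal one. -/
theorem minimalLever_of_inverseCM (hI : InverseCM) : MinimalLever := fun hM =>
  meanSquareBounded_of_tableChowla (operatorNormForm_iff.mp (operatorNormForm_of_inverse_meanSquare hI hM))

/-- The crux implies the minimal lever (trivially). -/
theorem minimalLever_of_tableChowla (h : LiouvilleShiftedTables.TableChowla) : MinimalLever := fun _ =>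
  meanSquareBounded_of_tableChowla h

/-- `MeanSquareCM` follows from the crux (through `MeanSquareBounded`, dropping the CM clause). -/
theorem meanSquareCM_of_tableChowla (h : LiouvilleShiftedTables.TableChowla) : MeanSquareCM := by
  intro c hc δ hδ hδ' C hC
  obtain ⟨x₀, hx₀⟩ := meanSquareBounded_of_tableChowla h c hc δ hδ hδ' C hC
  exact ⟨x₀, fun x hx A hA hA' g _ hgb y hy => hx₀ x hx A hA hA' g hgb y hy⟩

/-- EXACT TWO-STUB SPLITTING with the minimal lever: `TableChowla ↔ MinimalLever ∧ MeanSquareCM`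
(and `MeanSquareCM ↔ MeanSquareCMAperiodic` by (o)). -/
theorem tableChowla_iff_minimalLever :
    LiouvilleShiftedTables.TableChowla ↔ (MinimalLever ∧ MeanSquareCM) :=
  ⟨fun h => ⟨minimalLever_of_tableChowla h, meanSquareCM_of_tableChowla h⟩,
    fun h => tableChowla_of_meanSquareBounded (h.1 h.2)⟩

end

end Summit.Parity.GeneralizedHardyLittlewood.Cruxes.TableChowla.DisproofGen3
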